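import Summits.QuantumFields.YangMills.Theorems.UnitScaleTiltProp7AxialGauge
import Literature.MathematicalPhysics.QuantumFieldTheory.Balaban1983to89.BlockAveragingExpMeanLogContinuous
import Literature.MathematicalPhysics.QuantumFieldTheory.Balaban1983to89.B15Prop1Carrier
import Literature.MathematicalPhysics.QuantumFieldTheory.Balaban1983to89.T3NestedUnitLaws
import Summits.QuantumFields.YangMills.Theorems.FluctuationComparisonRegPrIntLOrganTangentUniqMaxResidualGauge
import HarnessLib

/-!
# Crux `FluctuationComparisonRegPrIntL` (stmt-QuantumFields-20520, rung R3), PATH-B organ O1, LINE g26-1 «mode_section», repair R-UNIQ (LEAD w3 g24,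
# 2026-08-30): THE RESIDUAL-GAUGE AXIAL SECTION — one CONTINUOUSLY CHOSEN representative per orbit of the group (4) «`u = 1` at the block centres»,
# and its orbit calculus

Cell `ym3-torus` (YM ladder rung R3 = continuum `SU(2)` Yang–Mills on the three-torus — a RUNG: NOT d = 4, NOT infinite volume, NOT a mass gap, NOT Clay).
Width seat `ym3-torus-px19` (gen 18); `--kind proof --supports stmt-QuantumFields-20520 --as helper`, count-neutral; DEFINITION-FREE (0 `def`, 0 `instance`,
0 `notation`, 0 `sorry`, default heartbeats).

WHY.  LEAD w3 g24's typing note R-UNIQ (✓`…OrganTangentUniqMaxResidualGauge`): a fibre maximiser of a gauge-invariant density over a datum of the one-step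
averaging `descend` is never POINTWISE unique — the residual group (4) («`w(y) = 1` at the block centres `y`», [Balaban1985Variational] (4) p. 278) moves
every configuration and preserves fibre, window and density — so the one-well letter of MODE∘ must read «unique MODULO the residual group», and the continuous
mode section is then obtained on a GAUGE-FIXED SLICE.  This file supplies the slice: the complete `k`-fold comb axial gauge of ✓`Prop7AxialGauge` (relative to a
background `U₀`; [Balaban1985RegularSpaces] (1.19) p. 79 «determine uniquely an element in each orbit given by the subgroup (1.14)») read as a MAP

  `axSec U₀ U := gaugeActT (fun x => (axialT U₀ (embIter k (iterBlockOf k x)) x)⁻¹ * axialT U (embIter k (iterBlockOf k x)) x) U`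

(written out in every statement — no definition is introduced), with: CONTINUITY in `(U₀, U)` (§1: torus transport `holT` and the comb holonomy `axialT` are
finite products of bond variables); the ORBIT CALCULUS (§2: the gauging element lies in (4); `axSec U₀ U` is axial; `axSec` is CONSTANT on residual orbits and
SEPARATES them — `axSec U₀ U = axSec U₀ U′ ↔ U′ = w • U` for a residual `w`; idempotent; `= U` iff `U` is axial; `axSec U₀ U₀ = U₀`); INVARIANTS (§3: plaquette
variables are conjugated, so `dist1`, `PlaqSmall` and every residual-invariant functional are unchanged; the slice `{U | axSec U₀ U = U}` is closed); and the
ONE-STEP READING at the objects of `descend F ℰ K` (§4: `k = 1`, centres `embIter 1 y = emb y`; `descend (axSec U₀ U) = descend U` by LEAD w3 g24's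
✓`…OrganTangentUniqMaxResidualGauge.descend_gaugeAct_of_residual`, [Balaban1985Averaging] (11) p. 19).

HONEST FRAMING: symmetry∕topology bookkeeping over ✓`Prop7AxialGauge` and lit ✓`B10Eq27TorusAxialLog`; nothing of Bałaban's analysis is asserted or proved;
R-UNIQ (as a letter), MODE∘, O1, the five registered ∘-stubs of `Lines/semiclassical_s2beta.lean` v11.4 (★★OWNER RULING №36, untouched), crux 20520 and
`YM3TorusSU2` are NOT proved; rung R3 = SU(2) YM₃ on T³ at fixed lattice data — NOT d = 4, NOT infinite volume, NOT a mass gap, NOT Clay; the Yang–Mills mass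
gap is NOT proved by any of this.

References: T. Bałaban, CMP **102** (1985) 277–309 [Balaban1985Variational] ((4) p.278, (16)–(18) p.280); CMP **99** (1985) 75–102 [Balaban1985RegularSpaces]
((1.14) p.78, (1.19) p.79); CMP **98** (1985) 17–51 [Balaban1985Averaging] ((8)–(9) pp.18–19, (11)–(13) p.19, p.24).
-/

set_option autoImplicit false

namespace Summit.QuantumFields.YangMills.Theorems.OrganTangentResidualAxialSection

open Topology Filter
open Literature.MathematicalPhysics.QuantumFieldTheory.Balaban1983to89
open B10Eq27TorusAxialLog (holT axialT gaugeActT gaugeActT_apply gaugeActT_eq_gaugeAct holT_nil holT_cons_true holT_cons_false axialT_self)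
open B7Prop1Explicit (Letter)
open B5Eq118OneStroke (iterBlockOf)
open B15DeterminingSets (embIter)
open Summit.QuantumFields.YangMills.Theorems.Prop7AxialGauge (axialT_gaugeActT axialGauge_unique)
open Literature.MathematicalPhysics.QuantumFieldTheory.BalabanImbrieJaffe1984to88.BIJ88RT51Background (iterBlockOf_embIter)

/-! ## §1 Continuity: transport, comb holonomy, the section -/

section Continuity

variable {P : Params} {j : ℕ} {G : Type*} [Group G] [TopologicalSpace G] [ContinuousMul G] [ContinuousInv G]

/-- Torus transport along a fixed lattice word is a continuous function of the configuration (a finite product of bond variables and their inverses;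
product topology). [cite: Balaban1985Averaging, (9) p.18] -/
theorem continuous_holT : ∀ (x : Site P j) (w : List (Letter P.d)), Continuous fun V : GaugeField P j G => holT V x w
  | x, [] => by simp only [holT_nil]; exact continuous_const
  | x, (μ, true) :: w => by
      simp only [holT_cons_true]
      exact (show Continuous fun V : GaugeField P j G => V ⟨x, μ⟩ from continuous_apply _).mul (continuous_holT (x.shift μ) w)
  | x, (μ, false) :: w => by
      simp only [holT_cons_false]
      exact (show Continuous fun V : GaugeField P j G => V ⟨x.unshift μ, μ⟩ from continuous_apply _).inv.mul
        (continuous_holT (x.unshift μ) w)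

/-- The comb holonomy `U(Γ_{y,x})` is a continuous function of `U`. [cite: Balaban1985Averaging, (9) p.18, p.24] -/
theorem continuous_axialT (y x : Site P j) : Continuous fun V : GaugeField P j G => axialT V y x :=
  continuous_holT y _

/-- The gauging element `v(x) = U₀(Γ_{y(x),x})⁻¹·U(Γ_{y(x),x})` of the comb axial gauge, at a fixed site, is jointly continuous in `(U₀, U)` (any centre
assignment `c`). [cite: Balaban1985Variational, (18) p.280] -/
theorem continuous_axElt (c : Site P j → Site P j) (x : Site P j) :
    Continuous fun q : GaugeField P j G × GaugeField P j G => (axialT q.1 (c x) x)⁻¹ * axialT q.2 (c x) x :=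
  ((continuous_axialT (c x) x).comp continuous_fst).inv.mul ((continuous_axialT (c x) x).comp continuous_snd)

/-- ★ **THE AXIAL SECTION IS JOINTLY CONTINUOUS IN `(U₀, U)`** (any centre assignment `c`; product topology on configurations).
[cite: Balaban1985Variational, (18) p.280; Balaban1985RegularSpaces, (1.19) p.79] -/
theorem continuous_axSec₂ (c : Site P j → Site P j) :
    Continuous fun q : GaugeField P j G × GaugeField P j G =>
      gaugeActT (fun x => (axialT q.1 (c x) x)⁻¹ * axialT q.2 (c x) x) q.2 := by
  refine continuous_pi fun b => ?_
  simp only [gaugeActT_apply]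
  exact ((continuous_axElt c b.src).mul (show Continuous fun q : GaugeField P j G × GaugeField P j G => q.2 b from
    (continuous_apply b).comp continuous_snd)).mul (continuous_axElt c b.tgt).inv

/-- ★ **THE AXIAL SECTION IS CONTINUOUS IN `U`** at a fixed background `U₀` (any centre assignment `c`). [cite: Balaban1985RegularSpaces, (1.19) p.79] -/
theorem continuous_axSec (c : Site P j → Site P j) (U₀ : GaugeField P j G) :
    Continuous fun U : GaugeField P j G => gaugeActT (fun x => (axialT U₀ (c x) x)⁻¹ * axialT U (c x) x) U :=
  (continuous_axSec₂ c).comp (Continuous.prodMk_right U₀)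

/-- The axial slice `{U | axSec U₀ U = U}` is CLOSED (Hausdorff structure group). [cite: Balaban1985RegularSpaces, (1.19) p.79] -/
theorem isClosed_setOf_axSec_eq [T2Space G] (c : Site P j → Site P j) (U₀ : GaugeField P j G) :
    IsClosed {U : GaugeField P j G | gaugeActT (fun x => (axialT U₀ (c x) x)⁻¹ * axialT U (c x) x) U = U} := by
  haveI : T2Space (GaugeField P j G) := inferInstanceAs (T2Space (PBond P j → G))
  exact isClosed_eq (continuous_axSec c U₀) continuous_id

end Continuity

/-! ## §2 Orbit calculus of the section (group (4) = `w = 1` at the `k`-fold block centres) -/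

section Algebra

variable {P : Params} {G : Type*} [Group G] {k : ℕ}

/-- Composition of gauge actions: `(V^b)^a = V^{a·b}`. [cite: Balaban1985Averaging, (8) p.19] -/
theorem gaugeActT_gaugeActT (a b : GaugeTransf P 0 G) (V : GaugeField P 0 G) :
    gaugeActT a (gaugeActT b V) = gaugeActT (fun x => a x * b x) V := by
  funext bd
  simp only [gaugeActT_apply, mul_inv_rev, mul_assoc]

/-- The trivial gauge transformation acts trivially (torus-action spelling of lit ✓`T4AxialGaugeFixing.gaugeAct_const_one`). [cite: Balaban1985Averaging, (8) p.19] -/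
theorem gaugeActT_one (V : GaugeField P 0 G) : gaugeActT (fun _ => (1 : G)) V = V := by
  funext b
  simp only [gaugeActT_apply, one_mul, inv_one, mul_one]

/-- Undoing a gauge action: `(V^a)^{a⁻¹} = V`. [cite: Balaban1985Averaging, (8) p.19] -/
theorem gaugeActT_inv_gaugeActT (a : GaugeTransf P 0 G) (V : GaugeField P 0 G) :
    gaugeActT (fun x => (a x)⁻¹) (gaugeActT a V) = V := by
  rw [gaugeActT_gaugeActT]
  simp only [inv_mul_cancel]
  exact gaugeActT_one V

/-- **The gauging element lies in the group (4)**: `v = 1` at every `k`-fold block centre. [cite: Balaban1985Variational, (4) p.278 and (18) p.280] -/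
theorem axElt_embIter (hk : k ≤ P.m + P.K) (U₀ U : GaugeField P 0 G) (y : Site P k) :
    (axialT U₀ (embIter k (iterBlockOf k (embIter k y))) (embIter k y))⁻¹ *
        axialT U (embIter k (iterBlockOf k (embIter k y))) (embIter k y) = 1 := by
  simp only [iterBlockOf_embIter k hk y, axialT_self, inv_one, mul_one]

/-- **The section lands in the comb axial gauge relative to `U₀`.** [cite: Balaban1985Variational, (18) p.280; Balaban1985RegularSpaces, (1.19) p.79] -/
theorem axSec_isAxial (hk : k ≤ P.m + P.K) (U₀ U : GaugeField P 0 G) (x : Site P 0) :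
    axialT (gaugeActT (fun x => (axialT U₀ (embIter k (iterBlockOf k x)) x)⁻¹ * axialT U (embIter k (iterBlockOf k x)) x) U)
        (embIter k (iterBlockOf k x)) x = axialT U₀ (embIter k (iterBlockOf k x)) x := by
  rw [axialT_gaugeActT]
  simp only [iterBlockOf_embIter k hk, axialT_self, inv_one, one_mul, mul_inv_rev, inv_inv, mul_inv_cancel_left]

/-- **Uniqueness reading**: any element `v` of the group (4) that gauges `U` axially produces the section's value.
[cite: Balaban1985RegularSpaces, p.79 (sentence after (1.20))] -/
theorem axSec_eq_gaugeActT_of_axial (hk : k ≤ P.m + P.K) (U₀ U : GaugeField P 0 G) (v : GaugeTransf P 0 G)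
    (hv : ∀ y : Site P k, v (embIter k y) = 1)
    (hvU : ∀ x : Site P 0, axialT (gaugeActT v U) (embIter k (iterBlockOf k x)) x = axialT U₀ (embIter k (iterBlockOf k x)) x) :
    gaugeActT (fun x => (axialT U₀ (embIter k (iterBlockOf k x)) x)⁻¹ * axialT U (embIter k (iterBlockOf k x)) x) U = gaugeActT v U := by
  rw [axialGauge_unique (k := k) U₀ U
    (fun x => (axialT U₀ (embIter k (iterBlockOf k x)) x)⁻¹ * axialT U (embIter k (iterBlockOf k x)) x) v
    (fun y => axElt_embIter hk U₀ U y) hv (axSec_isAxial hk U₀ U) hvU]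

/-- ★ **THE SECTION IS CONSTANT ON RESIDUAL ORBITS**: for `w` in the group (4), `axSec U₀ (w • U) = axSec U₀ U`.
[cite: Balaban1985RegularSpaces, (1.14) p.78 and p.79 (sentence after (1.20))] -/
theorem axSec_gaugeActT_of_residual (hk : k ≤ P.m + P.K) (U₀ U : GaugeField P 0 G) (w : GaugeTransf P 0 G)
    (hw : ∀ y : Site P k, w (embIter k y) = 1) :
    gaugeActT (fun x => (axialT U₀ (embIter k (iterBlockOf k x)) x)⁻¹ * axialT (gaugeActT w U) (embIter k (iterBlockOf k x)) x) (gaugeActT w U)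
      = gaugeActT (fun x => (axialT U₀ (embIter k (iterBlockOf k x)) x)⁻¹ * axialT U (embIter k (iterBlockOf k x)) x) U := by
  -- `axSec U₀ (w • U) = (v′·w) • U` with `v′·w` in (4) and axial ⇒ it is `axSec U₀ U` by uniqueness
  rw [gaugeActT_gaugeActT]
  symm
  refine axSec_eq_gaugeActT_of_axial hk U₀ U _ (fun y => ?_) (fun x => ?_)
  · show (axialT U₀ (embIter k (iterBlockOf k (embIter k y))) (embIter k y))⁻¹ *
        axialT (gaugeActT w U) (embIter k (iterBlockOf k (embIter k y))) (embIter k y) * w (embIter k y) = 1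
    simp only [iterBlockOf_embIter k hk y, axialT_self, inv_one, one_mul, hw y]
  · have hax := axSec_isAxial hk U₀ (gaugeActT w U) x
    rw [gaugeActT_gaugeActT] at hax
    exact hax

/-- The section's value lies on the residual orbit of `U` (the gauging element itself is the witness). [cite: Balaban1985Variational, (18) p.280] -/
theorem exists_residual_axSec_eq (hk : k ≤ P.m + P.K) (U₀ U : GaugeField P 0 G) :
    ∃ v : GaugeTransf P 0 G, (∀ y : Site P k, v (embIter k y) = 1) ∧
      gaugeActT (fun x => (axialT U₀ (embIter k (iterBlockOf k x)) x)⁻¹ * axialT U (embIter k (iterBlockOf k x)) x) U = gaugeActT v U :=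
  ⟨fun x => (axialT U₀ (embIter k (iterBlockOf k x)) x)⁻¹ * axialT U (embIter k (iterBlockOf k x)) x,
    fun y => axElt_embIter hk U₀ U y, rfl⟩

/-- ★ **THE SECTION SEPARATES RESIDUAL ORBITS**: `axSec U₀ U = axSec U₀ U′` iff `U′ = w • U` for some `w` in the group (4) — one representative per orbit.
[cite: Balaban1985RegularSpaces, p.79 (sentence after (1.20))] -/
theorem axSec_eq_axSec_iff (hk : k ≤ P.m + P.K) (U₀ U U' : GaugeField P 0 G) :
    gaugeActT (fun x => (axialT U₀ (embIter k (iterBlockOf k x)) x)⁻¹ * axialT U (embIter k (iterBlockOf k x)) x) U =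
        gaugeActT (fun x => (axialT U₀ (embIter k (iterBlockOf k x)) x)⁻¹ * axialT U' (embIter k (iterBlockOf k x)) x) U' ↔
      ∃ w : GaugeTransf P 0 G, (∀ y : Site P k, w (embIter k y) = 1) ∧ U' = gaugeActT w U := by
  constructor
  · intro h
    -- `U′ = v′⁻¹ • axSec U′ = v′⁻¹ • axSec U = (v′⁻¹·v) • U`
    refine ⟨fun x => ((axialT U₀ (embIter k (iterBlockOf k x)) x)⁻¹ * axialT U' (embIter k (iterBlockOf k x)) x)⁻¹ *
        ((axialT U₀ (embIter k (iterBlockOf k x)) x)⁻¹ * axialT U (embIter k (iterBlockOf k x)) x), fun y => ?_, ?_⟩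
    · simp only [iterBlockOf_embIter k hk y, axialT_self, inv_one, mul_one]
    · have h1 := gaugeActT_inv_gaugeActT
        (fun x => (axialT U₀ (embIter k (iterBlockOf k x)) x)⁻¹ * axialT U' (embIter k (iterBlockOf k x)) x) U'
      rw [← h, gaugeActT_gaugeActT] at h1
      exact h1.symm
  · rintro ⟨w, hw, rfl⟩
    exact (axSec_gaugeActT_of_residual hk U₀ U w hw).symm

/-- **Idempotence**: `axSec U₀ (axSec U₀ U) = axSec U₀ U`. [cite: Balaban1985RegularSpaces, (1.19) p.79] -/
theorem axSec_idem (hk : k ≤ P.m + P.K) (U₀ U : GaugeField P 0 G) :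
    gaugeActT (fun x => (axialT U₀ (embIter k (iterBlockOf k x)) x)⁻¹ *
        axialT (gaugeActT (fun x => (axialT U₀ (embIter k (iterBlockOf k x)) x)⁻¹ * axialT U (embIter k (iterBlockOf k x)) x) U)
          (embIter k (iterBlockOf k x)) x)
      (gaugeActT (fun x => (axialT U₀ (embIter k (iterBlockOf k x)) x)⁻¹ * axialT U (embIter k (iterBlockOf k x)) x) U) =
    gaugeActT (fun x => (axialT U₀ (embIter k (iterBlockOf k x)) x)⁻¹ * axialT U (embIter k (iterBlockOf k x)) x) U :=
  axSec_gaugeActT_of_residual hk U₀ U _ (fun y => axElt_embIter hk U₀ U y)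

/-- **Fixed points = axial configurations**: `axSec U₀ U = U` iff `U` is in the comb axial gauge relative to `U₀`. [cite: Balaban1985RegularSpaces, (1.19) p.79] -/
theorem axSec_eq_self_iff (hk : k ≤ P.m + P.K) (U₀ U : GaugeField P 0 G) :
    gaugeActT (fun x => (axialT U₀ (embIter k (iterBlockOf k x)) x)⁻¹ * axialT U (embIter k (iterBlockOf k x)) x) U = U ↔
      ∀ x : Site P 0, axialT U (embIter k (iterBlockOf k x)) x = axialT U₀ (embIter k (iterBlockOf k x)) x := by
  constructor
  · intro h x
    have hx := axSec_isAxial hk U₀ U x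
    rwa [h] at hx
  · intro h
    rw [axSec_eq_gaugeActT_of_axial hk U₀ U (fun _ => 1) (fun _ => rfl) (fun x => by rw [gaugeActT_one]; exact h x), gaugeActT_one]

/-- The background is its own representative: `axSec U₀ U₀ = U₀`. [cite: Balaban1985RegularSpaces, (1.19) p.79] -/
theorem axSec_self (hk : k ≤ P.m + P.K) (U₀ : GaugeField P 0 G) :
    gaugeActT (fun x => (axialT U₀ (embIter k (iterBlockOf k x)) x)⁻¹ * axialT U₀ (embIter k (iterBlockOf k x)) x) U₀ = U₀ :=
  (axSec_eq_self_iff hk U₀ U₀).2 fun _ => rfl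

/-- A residual-invariant functional does not see the section: `r (axSec U₀ U) = r U`. [cite: Balaban1985Averaging, (12)-(13) p.19] -/
theorem apply_axSec_of_residualInvariant (hk : k ≤ P.m + P.K) {α : Sort*} (r : GaugeField P 0 G → α)
    (hr : ∀ w : GaugeTransf P 0 G, (∀ y : Site P k, w (embIter k y) = 1) → ∀ U, r (gaugeActT w U) = r U) (U₀ U : GaugeField P 0 G) :
    r (gaugeActT (fun x => (axialT U₀ (embIter k (iterBlockOf k x)) x)⁻¹ * axialT U (embIter k (iterBlockOf k x)) x) U) = r U :=
  hr _ (fun y => axElt_embIter hk U₀ U y) U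

end Algebra

/-! ## §3 Invariants: plaquette variables, windows, gauge-invariant functionals -/

section Invariants

variable {P : Params} {G : Type*} [GaugeGroup G]

/-- A gauge-invariant functional does not see the section (any centre assignment). [cite: Balaban1985Averaging, (12)-(13) p.19] -/
theorem apply_axSec_of_gaugeInvariant {α : Type*} (r : GaugeField P 0 G → α) (hr : GaugeField.GaugeInvariant r)
    (c : Site P 0 → Site P 0) (U₀ U : GaugeField P 0 G) :
    r (gaugeActT (fun x => (axialT U₀ (c x) x)⁻¹ * axialT U (c x) x) U) = r U := by
  rw [gaugeActT_eq_gaugeAct]; exact hr _ _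

/-- Plaquette variables of the section are conjugates of those of `U`: `dist1` is unchanged (any centre assignment). [cite: Balaban1985Averaging, (12) p.19] -/
theorem dist1_plaqHol_axSec (c : Site P 0 → Site P 0) (U₀ U : GaugeField P 0 G) (p : Plaq P 0) :
    dist1 (GaugeField.plaqHol (gaugeActT (fun x => (axialT U₀ (c x) x)⁻¹ * axialT U (c x) x) U) p) = dist1 (GaugeField.plaqHol U p) := by
  rw [gaugeActT_eq_gaugeAct]; exact B15Prop1Carrier.dist1_plaqHol_gaugeAct _ _ _

/-- The small-field window is invariant under the section. [cite: Balaban1985Averaging, (12) p.19] -/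
theorem plaqSmall_axSec_iff (c : Site P 0 → Site P 0) (U₀ U : GaugeField P 0 G) (θ : ℝ) :
    PlaqSmall θ (gaugeActT (fun x => (axialT U₀ (c x) x)⁻¹ * axialT U (c x) x) U) ↔ PlaqSmall θ U := by
  simp only [PlaqSmall, dist1_plaqHol_axSec]

/-- The closed window is invariant under the section. [cite: Balaban1985Averaging, (12) p.19] -/
theorem forall_dist1_le_axSec_iff (c : Site P 0 → Site P 0) (U₀ U : GaugeField P 0 G) (θ : ℝ) :
    (∀ p, dist1 (GaugeField.plaqHol (gaugeActT (fun x => (axialT U₀ (c x) x)⁻¹ * axialT U (c x) x) U) p) ≤ θ) ↔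
      ∀ p, dist1 (GaugeField.plaqHol U p) ≤ θ := by
  simp only [dist1_plaqHol_axSec]

end Invariants

/-! ## §4 The one-step reading at the objects of `descend F ℰ K` (`k = 1`; centres `embIter 1 y = emb y`) -/

section OneStep

open Literature.MathematicalPhysics.QuantumFieldTheory.Balaban1983to89.T3ContinuumYM3Torus

variable (F : T3Family) {G : Type*} [GaugeGroup G] (ℰ : LoopAverage G)

/-- The standing range at `k = 1` on the `(K+1)`-th torus of the family. [cite: Balaban1987RG1, (0.1) p.252] -/
theorem one_le_range (K : ℕ) : 1 ≤ (F.P (K + 1)).m + (F.P (K + 1)).K := by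
  change 1 ≤ F.m + (K + 1); omega

/-- The residual condition of LEAD's R-UNIQ («`w (emb y) = 1` for every coarse `y`») IS the `k = 1` condition of §2 (`embIter 1 y = emb y`).
[cite: Balaban1985Variational, (4) p.278] -/
theorem residual_iff_embIter_one (K : ℕ) (w : GaugeTransf (F.P (K + 1)) 0 G) :
    (∀ y : Site (F.P (K + 1)) 1, w (emb y) = 1) ↔ ∀ y : Site (F.P (K + 1)) 1, w (embIter 1 y) = 1 :=
  Iff.rfl

/-- ★ **THE ONE-STEP AVERAGING DOES NOT SEE THE SECTION**: `descend (axSec U₀ U) = descend U` (the gauging element is `1` at the centres `emb y`, and the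
block averaging of record is covariant: LEAD w3 g24's ✓`OrganTangentUniqMaxResidualGauge.descend_gaugeAct_of_residual` BY NAME). [cite: Balaban1985Averaging, (11) p.19; Balaban1987RG1, (0.4) p.253] -/
theorem descend_axSec (K : ℕ) (U₀ U : GaugeField (F.P (K + 1)) 0 G) :
    T3NestedUnitLaws.descend F ℰ K
        (gaugeActT (fun x => (axialT U₀ (embIter 1 (iterBlockOf 1 x)) x)⁻¹ * axialT U (embIter 1 (iterBlockOf 1 x)) x) U) =
      T3NestedUnitLaws.descend F ℰ K U := by
  rw [gaugeActT_eq_gaugeAct]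
  exact OrganTangentUniqMaxResidualGauge.descend_gaugeAct_of_residual F ℰ K _
    (fun y => axElt_embIter (k := 1) (one_le_range F K) U₀ U y) U

/-- The one-step section is constant on residual orbits, in R-UNIQ's spelling of the residual group. [cite: Balaban1985RegularSpaces, p.79 (sentence after (1.20))] -/
theorem axSec_gaugeAct_of_residual_one (K : ℕ) (U₀ U : GaugeField (F.P (K + 1)) 0 G) (w : GaugeTransf (F.P (K + 1)) 0 G)
    (hw : ∀ y : Site (F.P (K + 1)) 1, w (emb y) = 1) :
    gaugeActT (fun x => (axialT U₀ (embIter 1 (iterBlockOf 1 x)) x)⁻¹ *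
        axialT (GaugeField.gaugeAct w U) (embIter 1 (iterBlockOf 1 x)) x) (GaugeField.gaugeAct w U) =
      gaugeActT (fun x => (axialT U₀ (embIter 1 (iterBlockOf 1 x)) x)⁻¹ * axialT U (embIter 1 (iterBlockOf 1 x)) x) U := by
  rw [← gaugeActT_eq_gaugeAct]
  exact axSec_gaugeActT_of_residual (k := 1) (one_le_range F K) U₀ U w hw

/-- … and separates them: `axSec U₀ U = axSec U₀ U′ ↔ ∃ w, (∀ y, w (emb y) = 1) ∧ U′ = w • U`. [cite: Balaban1985RegularSpaces, p.79 (sentence after (1.20))] -/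
theorem axSec_eq_axSec_iff_one (K : ℕ) (U₀ U U' : GaugeField (F.P (K + 1)) 0 G) :
    gaugeActT (fun x => (axialT U₀ (embIter 1 (iterBlockOf 1 x)) x)⁻¹ * axialT U (embIter 1 (iterBlockOf 1 x)) x) U =
        gaugeActT (fun x => (axialT U₀ (embIter 1 (iterBlockOf 1 x)) x)⁻¹ * axialT U' (embIter 1 (iterBlockOf 1 x)) x) U' ↔
      ∃ w : GaugeTransf (F.P (K + 1)) 0 G, (∀ y : Site (F.P (K + 1)) 1, w (emb y) = 1) ∧ U' = GaugeField.gaugeAct w U :=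
  axSec_eq_axSec_iff (k := 1) (one_le_range F K) U₀ U U'

end OneStep

end Summit.QuantumFields.YangMills.Theorems.OrganTangentResidualAxialSection
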